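import Literature.AnabelianGeometry.EtaleTheta.Discharge.Sec2Cor219iiiHeartLocallyConstant
import HarnessLib

/-!
# [EtTh] Cor. 2.19 (iii): the Δ_P-heart from uniqueness and ONE equation at `b` (abc-iut-f-142's assembly at a single value)
# — the socket for the even-level heart and for a level-constant conjugator (row «COR219III-M1b»; proof-only, generic)

S. Mochizuki, *The Étale Theta Function and its Frobenioid-theoretic Manifestations* [EtTh], Publ. RIMS **45** (2009), §2
Cor. 2.19 (iii) p. 64 [cite: MochizukiEtTh2009, Cor 2.19 (iii) p.64].  Cell `abc-iut`, row «COR219III-M1b» (abc-iut-L6-lead gen 7,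
K-L6 / F-0650), seat abc-iut-L1-t6 (gen 5).  PROOF-ONLY and GENERIC over every §1 setting `D` (no model): abc-iut-f-142's
`heart_of_uniqueness_of_onto` (`Sec2Cor219iiiHeartPrelims` §6, p477045) assembles the level-`M` Δ_P-heart from (D1*) uniqueness on
`Δ_P` and (D1′) «the commutator character `m ↦ red_M θ⁅(ã^m)⁻¹, b⁆` is ONTO `μ_M`»; its proof USES (D1′) at exactly ONE value,
the discrepancy `u₀ := red_M(F b)·red_M(f b)⁻¹`.  At the Tate model (D1′) is FALSE at even levels (abc-iut-L1-t6
`Sec2Cor219iiiHgenParityAtModelChi`, p487040: the character takes values in the squares of `μ_M`), so the honest socket is the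
single-value form: **`heart_of_uniqueness_at`** / **`heart_of_uniqueness_at'`** — given `m` with `red_M θ⁅(ã^m)⁻¹, b⁆ = u₀`, the
heart holds FOR THAT `m` (proof = f-142's, verbatim after its first line; nothing of another seat restated — the generic §1–§5 lemmas
are consumed BY NAME).  Consumers: row «COR219III-M1b-EVEN (β)» (abc-iut-w5-d125: `u₀` is a square / comes from the inner part of
an admissible `γ = Ad(w) ∘ Galois-type`), and the level-COMPATIBLE knit of abc-iut-C-hgal-2's `cor219_iii_of_hearts` with a
CONSTANT `x M := ã^m` (its clause (b2) is then `rfl`).  HONEST FRAMING: statements about OUR typed objects over an abstract §1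
setting; nothing of [EtTh] (refereed) is asserted for a curve; no side is taken on [IUTchIII] Cor. 3.12; typed ≠ proved.
-/

noncomputable section

namespace Literature.AnabelianGeometry.EtaleTheta

open Literature.AnabelianGeometry.SemiGraphs

namespace ThetaSetting.EtaleThetaData.DoubleUnderline

variable {p : ℕ} [Fact p.Prime] {D : ThetaSetting p} {E : D.EtaleThetaData} {l : ℕ}
  (C : E.DoubleUnderline l) {Es : Set ℕ+} (τ : D.CyclotomeTower l Es)

/-- **The Δ_P-heart from uniqueness and ONE equation at `b`** — abc-iut-f-142's assembly `heart_of_uniqueness_of_onto`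
(p477045) with its surjectivity hypothesis `honto` WEAKENED to the single value it is used at: given `m : ℤ` with
`red_M θ⁅(ã^m)⁻¹, b⁆ = red_M(F b)·red_M(f b)⁻¹`, the two locally constant multiplicative maps `red_M ∘ F` and
`red_M ∘ conjRoot (ã^m) f` agree on `Δ_P ∩ θ⁻¹(Δ_Θ)` (transport tautology) and at `b`, hence on all of `Δ_P` by (D1*).
This is the socket for the EVEN-level heart (row «COR219III-M1b-EVEN (β)»: `u₀ := red_M(F b)·red_M(f b)⁻¹` is a square)
and for a level-CONSTANT `x M := ã^m`; proof = f-142's, verbatim after its first line. [cite: MochizukiEtTh2009, Cor 2.19 (iii) p.64] -/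
theorem heart_of_uniqueness_at (hC : D.Compat) (hS : D.Sec2Hyps) (h15 : Prop15iii E hC)
    (γ : (C.thetaEnvTower τ hC hS).PiX ≃ₜ* (C.thetaEnvTower τ hC hS).PiX)
    (hγ : (C.thetaEnvTower τ hC hS).PiYdd.map γ.toMulEquiv.toMonoidHom = (C.thetaEnvTower τ hC hS).PiYdd)
    (hL : (C.thetaEnvTower τ hC hS).lDeltaTheta.map γ.toMulEquiv.toMonoidHom = (C.thetaEnvTower τ hC hS).lDeltaTheta)
    (γΛ : D.lDeltaTheta l ≃* D.lDeltaTheta l)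
    (hγΛ : ∀ (g : (C.thetaEnvTower τ hC hS).lDeltaTheta) (hg : γ g ∈ (C.thetaEnvTower τ hC hS).lDeltaTheta),
      C.toLDelta ⟨γ g, hg⟩ = γΛ (C.toLDelta g))
    {f : contCocycles D.toTheta D.DeltaTheta C.GtpYdduu} (hf : f ∈ C.rootCocycles hC)
    (F : C.GtpYdduu → D.lDeltaTheta l)
    (hF : ∀ g : (C.thetaEnvTower τ hC hS).PiYdd,
      F (C.inclYdduu g) = γΛ.symm ⟨(f.1 (C.inclYdduu ⟨γ g, C.apply_mem_PiYdd τ hC hS γ hγ g⟩) : D.GtpTheta), hf.1 _⟩)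
    (hFmul : ∀ g h : C.GtpYdduu, (F (g * h) : D.GtpTheta) =
      (F g : D.GtpTheta) * (D.toTheta (g : D.PiTemp) * (F h : D.GtpTheta) * (D.toTheta (g : D.PiTemp))⁻¹))
    (a : C.Huu) (ha : D.aug.toMonoidHom (a : D.PiTemp) = 1)
    (b : (C.thetaEnvTower τ hC hS).PiYdd) (hb : D.aug.toMonoidHom ((b : C.Huu) : D.PiTemp) = 1) (M : Es)
    -- (D1*) uniqueness on `Δ_P`
    (huniq : ∀ φ ψ : (C.thetaEnvTower τ hC hS).PiYdd → MuN p M, IsLocallyConstant φ → IsLocallyConstant ψ →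
      (∀ g h : (C.thetaEnvTower τ hC hS).PiYdd, D.aug.toMonoidHom ((g : C.Huu) : D.PiTemp) = 1 →
        D.aug.toMonoidHom ((h : C.Huu) : D.PiTemp) = 1 → φ (g * h) = φ g * φ h) →
      (∀ g h : (C.thetaEnvTower τ hC hS).PiYdd, D.aug.toMonoidHom ((g : C.Huu) : D.PiTemp) = 1 →
        D.aug.toMonoidHom ((h : C.Huu) : D.PiTemp) = 1 → ψ (g * h) = ψ g * ψ h) →
      (∀ g : (C.thetaEnvTower τ hC hS).PiYdd, D.aug.toMonoidHom ((g : C.Huu) : D.PiTemp) = 1 →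
        D.toTheta ((g : C.Huu) : D.PiTemp) ∈ D.DeltaTheta → φ g = ψ g) →
      φ b = ψ b →
      ∀ g : (C.thetaEnvTower τ hC hS).PiYdd, D.aug.toMonoidHom ((g : C.Huu) : D.PiTemp) = 1 → φ g = ψ g)
    -- (D1′ at ONE value) the commutator character at `b` hits THE discrepancy `red_M(F b)·red_M(f b)⁻¹` for the given `m`
    (m : ℤ)
    (hm : D.toTheta ((((a ^ m : C.Huu) : D.PiTemp))⁻¹ * ((b : C.Huu) : D.PiTemp) *
        ((a ^ m : C.Huu) : D.PiTemp) * (((b : C.Huu) : D.PiTemp))⁻¹) ∈ D.lDeltaTheta l)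
    (hred : (τ.mod M).red ⟨_, hm⟩ = (τ.mod M).red (F (C.inclYdduu b)) *
      ((τ.mod M).red ⟨(f.1 (C.inclYdduu b) : D.GtpTheta), hf.1 _⟩)⁻¹)
    -- local constancy of the two sides
    (hFlc : IsLocallyConstant fun g : (C.thetaEnvTower τ hC hS).PiYdd => (τ.mod M).red (F (C.inclYdduu g)))
    (hclc : IsLocallyConstant fun g : (C.thetaEnvTower τ hC hS).PiYdd =>
      (τ.mod M).red ⟨(C.conjRoot hC (a ^ m) f.1 (C.inclYdduu g) : D.GtpTheta),
        (D.lDeltaTheta_normal l).conj_mem _ (hf.1 _) _⟩) :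
    ∀ g : (C.thetaEnvTower τ hC hS).PiYdd, D.aug.toMonoidHom ((g : C.Huu) : D.PiTemp) = 1 →
      (τ.mod M).red (F (C.inclYdduu g)) =
        (τ.mod M).red ⟨(C.conjRoot hC (a ^ m) f.1 (C.inclYdduu g) : D.GtpTheta),
          (D.lDeltaTheta_normal l).conj_mem _ (hf.1 _) _⟩ := by
  have ham : D.aug.toMonoidHom ((a ^ m : C.Huu) : D.PiTemp) = 1 := by
    rw [Subgroup.coe_zpow, map_zpow, ha, one_zpow]
  refine huniq _ _ hFlc hclc ?_ ?_ ?_ ?_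
  · -- `red_M ∘ F` is multiplicative on `Δ_P`
    intro g h hg _
    rw [map_mul, C.transport_mul_of_aug_eq_one F hFmul _ _ hg, map_mul]
  · -- `red_M ∘ conjRoot (ã^m) f` is multiplicative on `Δ_P`
    intro g h hg _
    rw [← map_mul]
    congr 1
    apply Subtype.ext
    change (C.conjRoot hC (a ^ m) f.1 (C.inclYdduu (g * h)) : D.GtpTheta) =
      (C.conjRoot hC (a ^ m) f.1 (C.inclYdduu g) : D.GtpTheta) * (C.conjRoot hC (a ^ m) f.1 (C.inclYdduu h) : D.GtpTheta)
    rw [map_mul, C.conjRoot_mul_of_aug_eq_one hC f (a ^ m) _ _ hg, Subgroup.coe_mul]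
  · -- agreement on `Δ_P ∩ θ⁻¹(Δ_Θ)` (§1)
    intro g _ hk
    congr 1
    apply Subtype.ext
    exact C.transport_coe_eq_conjRoot_coe_of_mem τ hC hS h15 γ hγ hL γΛ hγΛ hf F hF (a ^ m) g hk
  · -- agreement at `b` (§4 and the choice of `m`)
    have hsplit : (⟨(C.conjRoot hC (a ^ m) f.1 (C.inclYdduu b) : D.GtpTheta),
        (D.lDeltaTheta_normal l).conj_mem _ (hf.1 _) _⟩ : D.lDeltaTheta l) =
        ⟨_, hm⟩ * ⟨(f.1 (C.inclYdduu b) : D.GtpTheta), hf.1 _⟩ := by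
      apply Subtype.ext
      rw [Subgroup.coe_mul]
      exact C.conjRoot_pow_coe_eq hC h15 hf a ha m (C.inclYdduu b) hb
    rw [hsplit, map_mul, hred, inv_mul_cancel_right]

/-- **`heart_of_uniqueness_at` with the local-constancy hypotheses DISCHARGED** (abc-iut-f-142's `transport_red_isLocallyConstant` /
`conjRoot_red_isLocallyConstant`, p477402), given the admitted `γ̄_M` and clause (c) `hFc` of the transport — the twin of f-142's
`heart_of_uniqueness_of_onto'` at ONE value. [cite: MochizukiEtTh2009, Cor 2.19 (iii) p.64] -/
theorem heart_of_uniqueness_at' (hC : D.Compat) (hS : D.Sec2Hyps) (h15 : Prop15iii E hC)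
    (γ : (C.thetaEnvTower τ hC hS).PiX ≃ₜ* (C.thetaEnvTower τ hC hS).PiX)
    (hγ : (C.thetaEnvTower τ hC hS).PiYdd.map γ.toMulEquiv.toMonoidHom = (C.thetaEnvTower τ hC hS).PiYdd)
    (hL : (C.thetaEnvTower τ hC hS).lDeltaTheta.map γ.toMulEquiv.toMonoidHom = (C.thetaEnvTower τ hC hS).lDeltaTheta)
    (γΛ : D.lDeltaTheta l ≃* D.lDeltaTheta l)
    (hγΛ : ∀ (g : (C.thetaEnvTower τ hC hS).lDeltaTheta) (hg : γ g ∈ (C.thetaEnvTower τ hC hS).lDeltaTheta),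
      C.toLDelta ⟨γ g, hg⟩ = γΛ (C.toLDelta g))
    (M : Es) (γμ : (C.thetaEnvTower τ hC hS).mu M ≃* (C.thetaEnvTower τ hC hS).mu M)
    {f : contCocycles D.toTheta D.DeltaTheta C.GtpYdduu} (hf : f ∈ C.rootCocycles hC)
    (F : C.GtpYdduu → D.lDeltaTheta l)
    (hF : ∀ g : (C.thetaEnvTower τ hC hS).PiYdd,
      F (C.inclYdduu g) = γΛ.symm ⟨(f.1 (C.inclYdduu ⟨γ g, C.apply_mem_PiYdd τ hC hS γ hγ g⟩) : D.GtpTheta), hf.1 _⟩)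
    (hFmul : ∀ g h : C.GtpYdduu, (F (g * h) : D.GtpTheta) =
      (F g : D.GtpTheta) * (D.toTheta (g : D.PiTemp) * (F h : D.GtpTheta) * (D.toTheta (g : D.PiTemp))⁻¹))
    (hFc : (C.thetaEnvTower τ hC hS).pullbackCocycle M γ hγ γμ (C.modN (τ.mod M) f hf.1) =
      fun g => (τ.mod M).red (F (C.inclYdduu g)))
    (a : C.Huu) (ha : D.aug.toMonoidHom (a : D.PiTemp) = 1)
    (b : (C.thetaEnvTower τ hC hS).PiYdd) (hb : D.aug.toMonoidHom ((b : C.Huu) : D.PiTemp) = 1)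
    (huniq : ∀ φ ψ : (C.thetaEnvTower τ hC hS).PiYdd → MuN p M, IsLocallyConstant φ → IsLocallyConstant ψ →
      (∀ g h : (C.thetaEnvTower τ hC hS).PiYdd, D.aug.toMonoidHom ((g : C.Huu) : D.PiTemp) = 1 →
        D.aug.toMonoidHom ((h : C.Huu) : D.PiTemp) = 1 → φ (g * h) = φ g * φ h) →
      (∀ g h : (C.thetaEnvTower τ hC hS).PiYdd, D.aug.toMonoidHom ((g : C.Huu) : D.PiTemp) = 1 →
        D.aug.toMonoidHom ((h : C.Huu) : D.PiTemp) = 1 → ψ (g * h) = ψ g * ψ h) →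
      (∀ g : (C.thetaEnvTower τ hC hS).PiYdd, D.aug.toMonoidHom ((g : C.Huu) : D.PiTemp) = 1 →
        D.toTheta ((g : C.Huu) : D.PiTemp) ∈ D.DeltaTheta → φ g = ψ g) →
      φ b = ψ b →
      ∀ g : (C.thetaEnvTower τ hC hS).PiYdd, D.aug.toMonoidHom ((g : C.Huu) : D.PiTemp) = 1 → φ g = ψ g)
    (m : ℤ)
    (hm : D.toTheta ((((a ^ m : C.Huu) : D.PiTemp))⁻¹ * ((b : C.Huu) : D.PiTemp) *
        ((a ^ m : C.Huu) : D.PiTemp) * (((b : C.Huu) : D.PiTemp))⁻¹) ∈ D.lDeltaTheta l)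
    (hred : (τ.mod M).red ⟨_, hm⟩ = (τ.mod M).red (F (C.inclYdduu b)) *
      ((τ.mod M).red ⟨(f.1 (C.inclYdduu b) : D.GtpTheta), hf.1 _⟩)⁻¹) :
    ∀ g : (C.thetaEnvTower τ hC hS).PiYdd, D.aug.toMonoidHom ((g : C.Huu) : D.PiTemp) = 1 →
      (τ.mod M).red (F (C.inclYdduu g)) =
        (τ.mod M).red ⟨(C.conjRoot hC (a ^ m) f.1 (C.inclYdduu g) : D.GtpTheta),
          (D.lDeltaTheta_normal l).conj_mem _ (hf.1 _) _⟩ :=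
  C.heart_of_uniqueness_at τ hC hS h15 γ hγ hL γΛ hγΛ hf F hF hFmul a ha b hb M huniq m hm hred
    (C.transport_red_isLocallyConstant τ hC hS M γ hγ γμ hf F hFc)
    (C.conjRoot_red_isLocallyConstant τ hC hS M hf (a ^ m))

end ThetaSetting.EtaleThetaData.DoubleUnderline

end Literature.AnabelianGeometry.EtaleTheta

end
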